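import Summits.QuantumFields.YangMills.Theorems.UnitScaleTiltProp7ClosedFibreMinimiser
import HarnessLib

/-!
# Route `UnitScaleTilt`, crux K1 «MinimiserStabilityRegPr» (stmt-QuantumFields-19200, skeleton v10 {`stub_halvingStep`, `stub_existenceMinimalOrbit`}), route (β) for the stub EX —
# **THE PLAQUETTE-ONLY CLOSED FIBRE `(6̄ₚ)(e) = {|U(∂p) − 1| ≤ eL^{−2k}} ∩ 𝔅_k(V)` (NO divergence clause): the Wilson action attains its minimum on it, and
# `stub_existenceMinimalOrbit` ⇐ the ONE sentence «its minimisers over (7)-data with a (14)-background lie in 𝔘_k(e)» — a KKT problem with plaquette-shell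
# multipliers ONLY (the divergence bound (1.9) becomes a conclusion, as in Sect. F, not a constraint)**

Cell `ym3-torus` (HUMAN RULING D-0037, YM ladder rung R3), width seat `ym-ust-20520-w4` (g0); companion of `UnitScaleTiltProp7ClosedFibreMinimiser` (p591314) for
ym-ust-19200-w4's route-(β) programme (its step (iv): the closed-fibre twin of the halving last mile meets «active-constraint multipliers»; with the divergence clause dropped
from the constraint set only the plaquette shell `|U(∂p) − 1| = eL^{−2k}` can be active).  THEOREMS ONLY (0 `def`, 0 `sorry`, standard axioms).

* §1 `(6̄ₚ)(e) ∩ 𝔅_k(V)` is CLOSED and COMPACT for `e ≤ r`, `2r` admissible as in [Balaban1985Averaging] (53) (the descent is continuous on the closed plaquette class —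
  ★alpha-1's `MinimiserPin.continuousAt_descendTo_of_plaqLe`; no divergence clause is needed for that);
* §2 sandwich `(6)(e) ⊆ (6̄)(e) ⊆ (6̄ₚ)(e)` and the background of (14) lies in it;
* §3 ★ `exists_isMinOn_closedPlaqFibre` (+ `_of_background`): the Wilson action ATTAINS its minimum on `(6̄ₚ)(e) ∩ 𝔅_k(V)` when non-empty;
* §4 a plaquette-fibre minimiser lying in `𝔘_k(e)` (BOTH strict clauses of (2) — the divergence clause now as a PROPERTY) minimises over print's space (6)(e), over the
  two-clause closed fibre `(6̄)(e)`, and is R2-critical;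
* §5 ★★ `existenceMinimalOrbit_of_plaqInterior` ∕ `existenceMinimalOrbit_of_plaqInterior_allL`: the existence half of `Prop7From14NativeAt` = v10's `stub_existenceMinimalOrbit`
  text ⇐ INTERIORₚ := «for (7)-data `V` with a background `U₀ ∈ 𝔘_k(L³B₃ε₁) ∩ 𝔅_k(V)`, every minimiser of (5) over `(6̄ₚ)(O₁L³B₃ε₁) ∩ 𝔅_k(V)` lies in `𝔘_k(O₁L³B₃ε₁)`».
  INTERIORₚ is neither weaker nor stronger than the two-clause INTERIOR of the sibling a priori (different minimisation problems); it is the one whose first-order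
  condition carries plaquette multipliers only.

HONEST FRAMING.  Kernel bookkeeping (compactness, extreme-value theorem, radii); INTERIORₚ stays a hypothesis; nothing of [Balaban1985Variational] asserted; no stub∕crux∕count
moves; YM₃ on T³ is ladder rung R3 — not d = 4, not a mass gap, not Clay.

References: T. Bałaban, CMP **102** (1985) 277–309 [Balaban1985Variational] ((2)–(8) p.278, (14) p.280, Prop. 7 p.299, Sect. F (158) p.302, Prop. 8 p.304); CMP **98** (1985)
17–51 [Balaban1985Averaging] (Prop. 2 (52)–(54) p.26); CMP **99** (1985) 75–102 [Balaban1985RegularSpaces] ((1.7)–(1.9) p.77).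
-/

set_option autoImplicit false

noncomputable section

namespace Summit.QuantumFields.YangMills.Theorems.Prop7ClosedFibreMinimiser

open Set Filter Topology
open scoped Matrix.Norms.L2Operator
open Literature.MathematicalPhysics.QuantumFieldTheory.Balaban1983to89
open Literature.MathematicalPhysics.QuantumFieldTheory.Balaban1983to89.T3ContinuumYM3Torus
open Literature.MathematicalPhysics.QuantumFieldTheory.Balaban1983to89.T3UnitLawDensityEML (ℰp)
open Literature.MathematicalPhysics.QuantumFieldTheory.Balaban1983to89.T3PrintedRegularMinimiser (RegPr DivSmall regFibrePr)
open Literature.MathematicalPhysics.QuantumFieldTheory.Balaban1983to89.T3PrintedMinimiserExistence (regFibrePr_mono regThreshold_mono regPr_mono)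
open Literature.MathematicalPhysics.QuantumFieldTheory.Balaban1983to89.T3RegularMinimiser (regThreshold regFibre)
open Literature.MathematicalPhysics.QuantumFieldTheory.Balaban1983to89.T3ConstrainedMinimiser (fibre)
open Literature.MathematicalPhysics.QuantumFieldTheory.Balaban1983to89.T3TiltDescent (descendTo)
open Literature.MathematicalPhysics.QuantumFieldTheory.Balaban1983to89.T3Thm1CarrierNative (IsCritR2 isCritR2_of_isMinOn)
open Literature.MathematicalPhysics.QuantumFieldTheory.Balaban1983to89.B10Eq27TorusAxialLog (toUField unitsField)
open Literature.MathematicalPhysics.QuantumFieldTheory.Balaban1983to89.B10Eq68TorusRegularity (covDivT)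
open Literature.MathematicalPhysics.QuantumFieldTheory.Balaban1983to89.ExpMeanLog (deltaSU deltaSU_pos)
open Summit.QuantumFields.YangMills.BalabanUVNodes.N07DirectMethod (continuous_wilsonAction4 isCompact_of_isClosed_cfg)
open Summit.QuantumFields.YangMills.Theorems.MinimiserPin (continuousAt_descendTo_of_plaqLe isClosed_plaqLe regThreshold_eq)

/-! ## §1 The plaquette-only closed fibre is closed and compact -/

section Topology

variable (F : T3Family) {n K : ℕ} (h : n ≤ K)

/-- **`(6̄ₚ)(e) ∩ 𝔅_k(V)` IS CLOSED** for `e ≤ r`, `2r` admissible: the descent `D_{n,K}` is continuous on the closed plaquette class (every intermediate (0.4) average stays in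
the exp-mean-log guard, [Balaban1985Averaging] Prop. 2 — ★alpha-1's `continuousAt_descendTo_of_plaqLe`), so the fibre meets that class in a closed set; no divergence clause
enters. [cite: Balaban1985Variational, (2), (3) p.278; Balaban1985Averaging, Prop. 2 p.26] -/
theorem isClosed_closedPlaqFibre {r : ℝ} (hr : 0 < r)
    (hr3 : (143 * ((((3 + 4 : ℕ) : ℝ)) ^ 2 / 4) ^ 2) * (2 * r) ≤ 1 / 3)
    (hr2 : 2 * (2 * r) ≤ 2 * deltaSU (Fin 2) / (((3 + 4) * F.L : ℕ) : ℝ) ^ 2)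
    {e : ℝ} (he : e ≤ r) (V : GaugeField (F.P n) 0 (Matrix.specialUnitaryGroup (Fin 2) ℂ)) :
    IsClosed ({U : GaugeField (F.P K) 0 (Matrix.specialUnitaryGroup (Fin 2) ℂ) | ∀ p : Plaq (F.P K) 0,
        GaugeGroup.dist1 (GaugeField.plaqHol U p) ≤ regThreshold F n K e} ∩ descendTo F ℰp n K h ⁻¹' {V}) := by
  haveI : T2Space (GaugeField (F.P n) 0 (Matrix.specialUnitaryGroup (Fin 2) ℂ)) :=
    inferInstanceAs (T2Space (PBond (F.P n) 0 → Matrix.specialUnitaryGroup (Fin 2) ℂ))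
  have hcont : ContinuousOn (descendTo F ℰp n K h) {U : GaugeField (F.P K) 0 (Matrix.specialUnitaryGroup (Fin 2) ℂ) |
      ∀ p : Plaq (F.P K) 0, GaugeGroup.dist1 (GaugeField.plaqHol U p) ≤ regThreshold F n K e} :=
    fun _ hU => (continuousAt_descendTo_of_plaqLe F n K h hr hr3 hr2 (regThreshold_mono F he) hU).continuousWithinAt
  exact hcont.preimage_isClosed_of_isClosed (isClosed_plaqLe F K _) isClosed_singleton

/-- … hence COMPACT (`SU(2)^{bonds}` is compact). [cite: Balaban1985Variational, (2), (3) p.278] -/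
theorem isCompact_closedPlaqFibre {r : ℝ} (hr : 0 < r)
    (hr3 : (143 * ((((3 + 4 : ℕ) : ℝ)) ^ 2 / 4) ^ 2) * (2 * r) ≤ 1 / 3)
    (hr2 : 2 * (2 * r) ≤ 2 * deltaSU (Fin 2) / (((3 + 4) * F.L : ℕ) : ℝ) ^ 2)
    {e : ℝ} (he : e ≤ r) (V : GaugeField (F.P n) 0 (Matrix.specialUnitaryGroup (Fin 2) ℂ)) :
    IsCompact ({U : GaugeField (F.P K) 0 (Matrix.specialUnitaryGroup (Fin 2) ℂ) | ∀ p : Plaq (F.P K) 0,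
        GaugeGroup.dist1 (GaugeField.plaqHol U p) ≤ regThreshold F n K e} ∩ descendTo F ℰp n K h ⁻¹' {V}) :=
  isCompact_of_isClosed_cfg (N := 2) (isClosed_closedPlaqFibre F h hr hr3 hr2 he V)

end Topology

/-! ## §2 Sandwich and the background -/

section Sandwich

variable (F : T3Family) {n K : ℕ} (h : n ≤ K)

/-- **`(6)(e) ⊆ (6̄ₚ)(e)`**: print's open space lies in the plaquette-only closed fibre. [cite: Balaban1985Variational, (2), (6) p.278] -/
theorem regFibrePr_subset_closedPlaqFibre (e : ℝ) (V : GaugeField (F.P n) 0 (Matrix.specialUnitaryGroup (Fin 2) ℂ)) :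
    regFibrePr F n K h e V ⊆
      {U : GaugeField (F.P K) 0 (Matrix.specialUnitaryGroup (Fin 2) ℂ) | ∀ p : Plaq (F.P K) 0,
          GaugeGroup.dist1 (GaugeField.plaqHol U p) ≤ regThreshold F n K e} ∩ descendTo F ℰp n K h ⁻¹' {V} :=
  fun _ hU => ⟨fun p => (hU.1.2 p).le, hU.1.1⟩

/-- **`(6̄)(e) ⊆ (6̄ₚ)(e)`**: the two-clause closed fibre of the sibling lies in the plaquette-only one (drop the divergence clause). [cite: Balaban1985Variational, (2), (6) p.278] -/
theorem closedRegFibre_subset_closedPlaqFibre (e : ℝ) (V : GaugeField (F.P n) 0 (Matrix.specialUnitaryGroup (Fin 2) ℂ)) :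
    {U : GaugeField (F.P K) 0 (Matrix.specialUnitaryGroup (Fin 2) ℂ) | ∀ p : Plaq (F.P K) 0,
          GaugeGroup.dist1 (GaugeField.plaqHol U p) ≤ regThreshold F n K e} ∩ descendTo F ℰp n K h ⁻¹' {V} ∩
        {U | ∀ b : PBond (F.P K) 0, ‖covDivT 1 (unitsField (toUField U)) b.dir b.src‖ ≤ e * ((F.L : ℝ)⁻¹) ^ (3 * (K - n))} ⊆
      {U : GaugeField (F.P K) 0 (Matrix.specialUnitaryGroup (Fin 2) ℂ) | ∀ p : Plaq (F.P K) 0,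
          GaugeGroup.dist1 (GaugeField.plaqHol U p) ≤ regThreshold F n K e} ∩ descendTo F ℰp n K h ⁻¹' {V} :=
  Set.inter_subset_left

/-- **THE BACKGROUND OF (14) LIES IN `(6̄ₚ)(e)`** for `e₀ ≤ e` — non-emptiness in Prop. 7's regime. [cite: Balaban1985Variational, (14) p.280, Prop. 7 p.299] -/
theorem background_mem_closedPlaqFibre {e₀ e : ℝ} (h₀ : e₀ ≤ e) {V : GaugeField (F.P n) 0 (Matrix.specialUnitaryGroup (Fin 2) ℂ)}
    {U₀ : GaugeField (F.P K) 0 (Matrix.specialUnitaryGroup (Fin 2) ℂ)} (hreg : RegPr F n K e₀ U₀) (hfib : U₀ ∈ fibre F ℰp n K h V) :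
    U₀ ∈ {U : GaugeField (F.P K) 0 (Matrix.specialUnitaryGroup (Fin 2) ℂ) | ∀ p : Plaq (F.P K) 0,
          GaugeGroup.dist1 (GaugeField.plaqHol U p) ≤ regThreshold F n K e} ∩ descendTo F ℰp n K h ⁻¹' {V} :=
  regFibrePr_subset_closedPlaqFibre F h e V (regFibrePr_mono F h₀ V ⟨⟨hfib, hreg.1⟩, hreg.2⟩)

end Sandwich

/-! ## §3 ★ The direct method on the plaquette-only closed fibre -/

section DirectMethod

variable (F : T3Family) {n K : ℕ} (h : n ≤ K)

/-- ★ **THE WILSON ACTION ATTAINS ITS MINIMUM ON `(6̄ₚ)(e) ∩ 𝔅_k(V)`** (`e ≤ r`, `2r` admissible, the set non-empty): compactness §1 + continuity of (5) +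
the extreme-value theorem. [cite: Balaban1985Variational, (5)–(6) p.278, Prop. 7 p.299] -/
theorem exists_isMinOn_closedPlaqFibre {r : ℝ} (hr : 0 < r)
    (hr3 : (143 * ((((3 + 4 : ℕ) : ℝ)) ^ 2 / 4) ^ 2) * (2 * r) ≤ 1 / 3)
    (hr2 : 2 * (2 * r) ≤ 2 * deltaSU (Fin 2) / (((3 + 4) * F.L : ℕ) : ℝ) ^ 2)
    {e : ℝ} (he : e ≤ r) (V : GaugeField (F.P n) 0 (Matrix.specialUnitaryGroup (Fin 2) ℂ))
    (hne : ({U : GaugeField (F.P K) 0 (Matrix.specialUnitaryGroup (Fin 2) ℂ) | ∀ p : Plaq (F.P K) 0,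
        GaugeGroup.dist1 (GaugeField.plaqHol U p) ≤ regThreshold F n K e} ∩ descendTo F ℰp n K h ⁻¹' {V}).Nonempty) :
    ∃ Ū ∈ {U : GaugeField (F.P K) 0 (Matrix.specialUnitaryGroup (Fin 2) ℂ) | ∀ p : Plaq (F.P K) 0,
        GaugeGroup.dist1 (GaugeField.plaqHol U p) ≤ regThreshold F n K e} ∩ descendTo F ℰp n K h ⁻¹' {V},
      IsMinOn (fun W : GaugeField (F.P K) 0 (Matrix.specialUnitaryGroup (Fin 2) ℂ) => wilsonAction4 W)
        ({U : GaugeField (F.P K) 0 (Matrix.specialUnitaryGroup (Fin 2) ℂ) | ∀ p : Plaq (F.P K) 0,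
            GaugeGroup.dist1 (GaugeField.plaqHol U p) ≤ regThreshold F n K e} ∩ descendTo F ℰp n K h ⁻¹' {V}) Ū :=
  (isCompact_closedPlaqFibre F h hr hr3 hr2 he V).exists_isMinOn hne (continuous_wilsonAction4 (N := 2)).continuousOn

/-- **… IN PRINT'S REGIME**: with a background `U₀ ∈ 𝔘_k(e₀) ∩ 𝔅_k(V)`, `e₀ ≤ e ≤ r`, a minimiser `Ū` of (5) over `(6̄ₚ)(e) ∩ 𝔅_k(V)` EXISTS, `A(Ū) ≤ A(U₀)`, and `A(Ū) ≤ A(U)`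
for every competitor `U` of the OPEN space (6)(e) and of the two-clause closed fibre `(6̄)(e)`. [cite: Balaban1985Variational, (5)–(6) p.278, (14) p.280, Prop. 7 p.299] -/
theorem exists_isMinOn_closedPlaqFibre_of_background {r : ℝ} (hr : 0 < r)
    (hr3 : (143 * ((((3 + 4 : ℕ) : ℝ)) ^ 2 / 4) ^ 2) * (2 * r) ≤ 1 / 3)
    (hr2 : 2 * (2 * r) ≤ 2 * deltaSU (Fin 2) / (((3 + 4) * F.L : ℕ) : ℝ) ^ 2)
    {e₀ e : ℝ} (h₀ : e₀ ≤ e) (he : e ≤ r) {V : GaugeField (F.P n) 0 (Matrix.specialUnitaryGroup (Fin 2) ℂ)}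
    {U₀ : GaugeField (F.P K) 0 (Matrix.specialUnitaryGroup (Fin 2) ℂ)} (hreg : RegPr F n K e₀ U₀) (hfib : U₀ ∈ fibre F ℰp n K h V) :
    ∃ Ū ∈ {U : GaugeField (F.P K) 0 (Matrix.specialUnitaryGroup (Fin 2) ℂ) | ∀ p : Plaq (F.P K) 0,
        GaugeGroup.dist1 (GaugeField.plaqHol U p) ≤ regThreshold F n K e} ∩ descendTo F ℰp n K h ⁻¹' {V},
      IsMinOn (fun W : GaugeField (F.P K) 0 (Matrix.specialUnitaryGroup (Fin 2) ℂ) => wilsonAction4 W)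
        ({U : GaugeField (F.P K) 0 (Matrix.specialUnitaryGroup (Fin 2) ℂ) | ∀ p : Plaq (F.P K) 0,
            GaugeGroup.dist1 (GaugeField.plaqHol U p) ≤ regThreshold F n K e} ∩ descendTo F ℰp n K h ⁻¹' {V}) Ū ∧
      wilsonAction4 Ū ≤ wilsonAction4 U₀ ∧
      ∀ U ∈ regFibrePr F n K h e V, wilsonAction4 Ū ≤ wilsonAction4 U := by
  obtain ⟨Ū, hŪ, hmin⟩ := exists_isMinOn_closedPlaqFibre F h hr hr3 hr2 he V ⟨U₀, background_mem_closedPlaqFibre F h h₀ hreg hfib⟩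
  exact ⟨Ū, hŪ, hmin, hmin (background_mem_closedPlaqFibre F h h₀ hreg hfib), fun U hU => hmin (regFibrePr_subset_closedPlaqFibre F h e V hU)⟩

end DirectMethod

/-! ## §4 A plaquette-fibre minimiser in `𝔘_k(e)` minimises over (6)(e), over `(6̄)(e)`, and is R2-critical -/

section Interior

variable (F : T3Family) {n K : ℕ} (h : n ≤ K)

/-- **INTERIOR PLAQUETTE-FIBRE MINIMISER ⇒ MINIMISER OVER PRINT'S SPACE (6)(e)** (membership in `𝔘_k(e)` supplies BOTH strict clauses; the divergence clause is a property
here, not a constraint). [cite: Balaban1985Variational, (5)–(6) p.278, Prop. 7 p.299] -/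
theorem isMinOn_regFibrePr_of_plaqInterior {e : ℝ} {V : GaugeField (F.P n) 0 (Matrix.specialUnitaryGroup (Fin 2) ℂ)}
    {Ū : GaugeField (F.P K) 0 (Matrix.specialUnitaryGroup (Fin 2) ℂ)}
    (hmin : IsMinOn (fun W : GaugeField (F.P K) 0 (Matrix.specialUnitaryGroup (Fin 2) ℂ) => wilsonAction4 W)
        ({U : GaugeField (F.P K) 0 (Matrix.specialUnitaryGroup (Fin 2) ℂ) | ∀ p : Plaq (F.P K) 0,
            GaugeGroup.dist1 (GaugeField.plaqHol U p) ≤ regThreshold F n K e} ∩ descendTo F ℰp n K h ⁻¹' {V}) Ū)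
    (hfib : Ū ∈ fibre F ℰp n K h V) (hint : RegPr F n K e Ū) :
    Ū ∈ regFibrePr F n K h e V ∧
      IsMinOn (fun W : GaugeField (F.P K) 0 (Matrix.specialUnitaryGroup (Fin 2) ℂ) => wilsonAction4 W) (regFibrePr F n K h e V) Ū :=
  ⟨⟨⟨hfib, hint.1⟩, hint.2⟩, hmin.on_subset (regFibrePr_subset_closedPlaqFibre F h e V)⟩

/-- … and over the two-clause closed fibre `(6̄)(e)` of the sibling (so everything proved there for closed-fibre minimisers applies to it). [cite: Balaban1985Variational, (5)–(6) p.278] -/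
theorem isMinOn_closedRegFibre_of_plaqInterior {e : ℝ} {V : GaugeField (F.P n) 0 (Matrix.specialUnitaryGroup (Fin 2) ℂ)}
    {Ū : GaugeField (F.P K) 0 (Matrix.specialUnitaryGroup (Fin 2) ℂ)}
    (hmin : IsMinOn (fun W : GaugeField (F.P K) 0 (Matrix.specialUnitaryGroup (Fin 2) ℂ) => wilsonAction4 W)
        ({U : GaugeField (F.P K) 0 (Matrix.specialUnitaryGroup (Fin 2) ℂ) | ∀ p : Plaq (F.P K) 0,
            GaugeGroup.dist1 (GaugeField.plaqHol U p) ≤ regThreshold F n K e} ∩ descendTo F ℰp n K h ⁻¹' {V}) Ū)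
    (hfib : Ū ∈ fibre F ℰp n K h V) (hint : RegPr F n K e Ū) :
    Ū ∈ {U : GaugeField (F.P K) 0 (Matrix.specialUnitaryGroup (Fin 2) ℂ) | ∀ p : Plaq (F.P K) 0,
          GaugeGroup.dist1 (GaugeField.plaqHol U p) ≤ regThreshold F n K e} ∩ descendTo F ℰp n K h ⁻¹' {V} ∩
        {U | ∀ b : PBond (F.P K) 0, ‖covDivT 1 (unitsField (toUField U)) b.dir b.src‖ ≤ e * ((F.L : ℝ)⁻¹) ^ (3 * (K - n))} ∧
      IsMinOn (fun W : GaugeField (F.P K) 0 (Matrix.specialUnitaryGroup (Fin 2) ℂ) => wilsonAction4 W)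
        ({U : GaugeField (F.P K) 0 (Matrix.specialUnitaryGroup (Fin 2) ℂ) | ∀ p : Plaq (F.P K) 0,
            GaugeGroup.dist1 (GaugeField.plaqHol U p) ≤ regThreshold F n K e} ∩ descendTo F ℰp n K h ⁻¹' {V} ∩
          {U | ∀ b : PBond (F.P K) 0, ‖covDivT 1 (unitsField (toUField U)) b.dir b.src‖ ≤ e * ((F.L : ℝ)⁻¹) ^ (3 * (K - n))}) Ū :=
  ⟨regFibrePr_subset_closedRegFibre F h e V (isMinOn_regFibrePr_of_plaqInterior F h hmin hfib hint).1,
    hmin.on_subset (closedRegFibre_subset_closedPlaqFibre F h e V)⟩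

/-- … and is CRITICAL in reading R2 (`e > 0`), so Prop. 8 ∕ the halving step read it. [cite: Balaban1985Variational, Prop. 8 p.304] -/
theorem isCritR2_of_plaqInterior {e : ℝ} (he : 0 < e) {V : GaugeField (F.P n) 0 (Matrix.specialUnitaryGroup (Fin 2) ℂ)}
    {Ū : GaugeField (F.P K) 0 (Matrix.specialUnitaryGroup (Fin 2) ℂ)}
    (hmin : IsMinOn (fun W : GaugeField (F.P K) 0 (Matrix.specialUnitaryGroup (Fin 2) ℂ) => wilsonAction4 W)
        ({U : GaugeField (F.P K) 0 (Matrix.specialUnitaryGroup (Fin 2) ℂ) | ∀ p : Plaq (F.P K) 0,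
            GaugeGroup.dist1 (GaugeField.plaqHol U p) ≤ regThreshold F n K e} ∩ descendTo F ℰp n K h ⁻¹' {V}) Ū)
    (hfib : Ū ∈ fibre F ℰp n K h V) (hint : RegPr F n K e Ū) : IsCritR2 F n K h V Ū :=
  isCritR2_of_isMinOn he (isMinOn_regFibrePr_of_plaqInterior F h hmin hfib hint).1 (isMinOn_regFibrePr_of_plaqInterior F h hmin hfib hint).2

end Interior

/-! ## §5 ★★ `stub_existenceMinimalOrbit` ⇐ INTERIORₚ (plaquette multipliers only) -/

section Existence

/-- ★★ **THE EXISTENCE CLAUSE OF PROP. 7 FROM A BACKGROUND (14), MEMBER LEVEL, ⇐ «PLAQUETTE-FIBRE MINIMISERS ARE IN 𝔘_k(e)».**  As the sibling's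
`existenceMinimalOrbit_of_interior`, with the minimisation over the plaquette-only closed fibre `(6̄ₚ)(O₁L³B₃ε₁) ∩ 𝔅_k(V)`: §3 supplies the minimiser, `hInt` puts it in
`𝔘_k(O₁L³B₃ε₁)` (both strict clauses), §4 concludes. [cite: Balaban1985Variational, Prop. 7 p.299, (14) p.280, Sect. F (158) p.302] -/
theorem existenceMinimalOrbit_of_plaqInterior (F : T3Family) {B₃ O₁ a₁' : ℝ} (hB₃ : 0 < B₃) (hO₁ : 1 ≤ O₁)
    (hA3 : (143 * ((((3 + 4 : ℕ) : ℝ)) ^ 2 / 4) ^ 2) * (2 * (O₁ * (F.L : ℝ) ^ 3 * B₃ * a₁')) ≤ 1 / 3)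
    (hA2 : 2 * (2 * (O₁ * (F.L : ℝ) ^ 3 * B₃ * a₁')) ≤ 2 * deltaSU (Fin 2) / (((3 + 4) * F.L : ℕ) : ℝ) ^ 2)
    (hInt : ∀ (n K : ℕ) (hnK : n < K) (ε₁ : ℝ), 0 < ε₁ → ε₁ ≤ a₁' →
      ∀ V : GaugeField (F.P n) 0 (Matrix.specialUnitaryGroup (Fin 2) ℂ), PlaqSmall ε₁ V →
        ∀ U₀ : GaugeField (F.P K) 0 (Matrix.specialUnitaryGroup (Fin 2) ℂ), RegPr F n K ((F.L : ℝ) ^ 3 * B₃ * ε₁) U₀ →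
          U₀ ∈ fibre F ℰp n K hnK.le V →
          ∀ Ū : GaugeField (F.P K) 0 (Matrix.specialUnitaryGroup (Fin 2) ℂ),
            Ū ∈ {U : GaugeField (F.P K) 0 (Matrix.specialUnitaryGroup (Fin 2) ℂ) | ∀ p : Plaq (F.P K) 0,
                  GaugeGroup.dist1 (GaugeField.plaqHol U p) ≤ regThreshold F n K (O₁ * (F.L : ℝ) ^ 3 * B₃ * ε₁)} ∩
                descendTo F ℰp n K hnK.le ⁻¹' {V} →
            IsMinOn (fun W : GaugeField (F.P K) 0 (Matrix.specialUnitaryGroup (Fin 2) ℂ) => wilsonAction4 W)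
              ({U : GaugeField (F.P K) 0 (Matrix.specialUnitaryGroup (Fin 2) ℂ) | ∀ p : Plaq (F.P K) 0,
                  GaugeGroup.dist1 (GaugeField.plaqHol U p) ≤ regThreshold F n K (O₁ * (F.L : ℝ) ^ 3 * B₃ * ε₁)} ∩
                descendTo F ℰp n K hnK.le ⁻¹' {V}) Ū →
            RegPr F n K (O₁ * (F.L : ℝ) ^ 3 * B₃ * ε₁) Ū)
    (n K : ℕ) (hnK : n < K) (ε₁ : ℝ) (hε₁ : 0 < ε₁)
    (V : GaugeField (F.P n) 0 (Matrix.specialUnitaryGroup (Fin 2) ℂ)) (hV : PlaqSmall ε₁ V)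
    (U₀ : GaugeField (F.P K) 0 (Matrix.specialUnitaryGroup (Fin 2) ℂ)) (hreg : RegPr F n K ((F.L : ℝ) ^ 3 * B₃ * ε₁) U₀)
    (hfib : U₀ ∈ fibre F ℰp n K hnK.le V) (hε₁a : ε₁ ≤ a₁') :
    ∃ U ∈ regFibrePr F n K hnK.le (O₁ * (F.L : ℝ) ^ 3 * B₃ * ε₁) V,
      IsMinOn (fun W : GaugeField (F.P K) 0 (Matrix.specialUnitaryGroup (Fin 2) ℂ) => wilsonAction4 W)
        (regFibrePr F n K hnK.le (O₁ * (F.L : ℝ) ^ 3 * B₃ * ε₁) V) U := by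
  have hLpos : (0 : ℝ) < F.L := by
    have := F.hL.2
    exact_mod_cast (by omega : 0 < F.L)
  have hO : 0 < O₁ := one_pos.trans_le hO₁
  have hr : 0 < O₁ * (F.L : ℝ) ^ 3 * B₃ * a₁' := by
    have : 0 < a₁' := hε₁.trans_le hε₁a
    positivity
  have he : O₁ * (F.L : ℝ) ^ 3 * B₃ * ε₁ ≤ O₁ * (F.L : ℝ) ^ 3 * B₃ * a₁' := mul_le_mul_of_nonneg_left hε₁a (by positivity)
  have h₀ : (F.L : ℝ) ^ 3 * B₃ * ε₁ ≤ O₁ * (F.L : ℝ) ^ 3 * B₃ * ε₁ := by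
    rw [show O₁ * (F.L : ℝ) ^ 3 * B₃ * ε₁ = O₁ * ((F.L : ℝ) ^ 3 * B₃ * ε₁) by ring]
    exact le_mul_of_one_le_left (by positivity) hO₁
  obtain ⟨Ū, hŪ, hmin, -, -⟩ := exists_isMinOn_closedPlaqFibre_of_background F hnK.le hr hA3 hA2 h₀ he hreg hfib
  have hint : RegPr F n K (O₁ * (F.L : ℝ) ^ 3 * B₃ * ε₁) Ū := hInt n K hnK ε₁ hε₁ hε₁a V hV U₀ hreg hfib Ū hŪ hmin
  exact ⟨Ū, isMinOn_regFibrePr_of_plaqInterior F hnK.le hmin hŪ.2 hint⟩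

/-- ★★ **v10's `stub_existenceMinimalOrbit` TEXT (∀ `L > 1`, ∀ `B₃ > 4`, ∃ `a′₁ O₁`, …) ⇐ INTERIORₚ FOR ALL `L`** — the uniform closure of `existenceMinimalOrbit_of_plaqInterior`,
`a″₁ ≤ a′₁` shrunk only to make `2·O₁L³B₃a″₁` admissible (as in the sibling's `existenceMinimalOrbit_of_interior_allL`). [cite: Balaban1985Variational, Prop. 7 p.299, (14) p.280] -/
theorem existenceMinimalOrbit_of_plaqInterior_allL
    (hInt : ∀ L : ℕ, 1 < L → ∀ B₃ : ℝ, 4 < B₃ → ∃ a₁' O₁ : ℝ, 0 < a₁' ∧ 1 ≤ O₁ ∧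
      ∀ F : T3Family, F.L = L → ∀ (n K : ℕ) (hnK : n < K) (ε₁ : ℝ), 0 < ε₁ → ε₁ ≤ a₁' →
        ∀ V : GaugeField (F.P n) 0 (Matrix.specialUnitaryGroup (Fin 2) ℂ), PlaqSmall ε₁ V →
          ∀ U₀ : GaugeField (F.P K) 0 (Matrix.specialUnitaryGroup (Fin 2) ℂ), RegPr F n K ((L : ℝ) ^ 3 * B₃ * ε₁) U₀ →
            U₀ ∈ fibre F ℰp n K hnK.le V →
            ∀ Ū : GaugeField (F.P K) 0 (Matrix.specialUnitaryGroup (Fin 2) ℂ),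
              Ū ∈ {U : GaugeField (F.P K) 0 (Matrix.specialUnitaryGroup (Fin 2) ℂ) | ∀ p : Plaq (F.P K) 0,
                    GaugeGroup.dist1 (GaugeField.plaqHol U p) ≤ regThreshold F n K (O₁ * (L : ℝ) ^ 3 * B₃ * ε₁)} ∩
                  descendTo F ℰp n K hnK.le ⁻¹' {V} →
              IsMinOn (fun W : GaugeField (F.P K) 0 (Matrix.specialUnitaryGroup (Fin 2) ℂ) => wilsonAction4 W)
                ({U : GaugeField (F.P K) 0 (Matrix.specialUnitaryGroup (Fin 2) ℂ) | ∀ p : Plaq (F.P K) 0,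
                    GaugeGroup.dist1 (GaugeField.plaqHol U p) ≤ regThreshold F n K (O₁ * (L : ℝ) ^ 3 * B₃ * ε₁)} ∩
                  descendTo F ℰp n K hnK.le ⁻¹' {V}) Ū →
              RegPr F n K (O₁ * (L : ℝ) ^ 3 * B₃ * ε₁) Ū) :
    ∀ L : ℕ, 1 < L → ∀ B₃ : ℝ, 4 < B₃ → ∃ a₁' O₁ : ℝ, 0 < a₁' ∧ 1 ≤ O₁ ∧
      ∀ F : T3Family, F.L = L → ∀ (n K : ℕ) (hnK : n < K) (ε₁ : ℝ), 0 < ε₁ →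
        ∀ V : GaugeField (F.P n) 0 (Matrix.specialUnitaryGroup (Fin 2) ℂ), PlaqSmall ε₁ V →
          ∀ U₀ : GaugeField (F.P K) 0 (Matrix.specialUnitaryGroup (Fin 2) ℂ), RegPr F n K ((L : ℝ) ^ 3 * B₃ * ε₁) U₀ →
            U₀ ∈ fibre F ℰp n K hnK.le V → ε₁ ≤ a₁' →
              ∃ U ∈ regFibrePr F n K hnK.le (O₁ * (L : ℝ) ^ 3 * B₃ * ε₁) V,
                IsMinOn (fun W : GaugeField (F.P K) 0 (Matrix.specialUnitaryGroup (Fin 2) ℂ) => wilsonAction4 W)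
                  (regFibrePr F n K hnK.le (O₁ * (L : ℝ) ^ 3 * B₃ * ε₁) V) U := by
  intro L hL B₃ hB₃
  obtain ⟨a₁', O₁, ha₁', hO₁, hI⟩ := hInt L hL B₃ hB₃
  set C : ℝ := 143 * ((((3 + 4 : ℕ) : ℝ)) ^ 2 / 4) ^ 2 with hC
  set M : ℝ := (((3 + 4) * L : ℕ) : ℝ) ^ 2 with hM
  have hCpos : 0 < C := by rw [hC]; positivity
  have hLpos : (0 : ℝ) < L := by exact_mod_cast (by omega : 0 < L)
  have hMpos : 0 < M := by
    rw [hM]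
    have : (0 : ℝ) < (((3 + 4) * L : ℕ) : ℝ) := by push_cast; positivity
    positivity
  have hδ := deltaSU_pos (n := Fin 2)
  set r : ℝ := min (1 / (6 * C)) (deltaSU (Fin 2) / (2 * M)) with hr_def
  have hr : 0 < r := lt_min (by positivity) (by positivity)
  have hr3 : C * (2 * r) ≤ 1 / 3 := by
    calc C * (2 * r) ≤ C * (2 * (1 / (6 * C))) := by gcongr; exact min_le_left _ _
      _ = 1 / 3 := by field_simp; ring
  have hr2 : 2 * (2 * r) ≤ 2 * deltaSU (Fin 2) / M := by
    calc 2 * (2 * r) ≤ 2 * (2 * (deltaSU (Fin 2) / (2 * M))) := by gcongr; exact min_le_right _ _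
      _ = 2 * deltaSU (Fin 2) / M := by field_simp
  have hB₃pos : 0 < B₃ := by linarith
  have hO₁pos : 0 < O₁ := one_pos.trans_le hO₁
  have hD : 0 < O₁ * (L : ℝ) ^ 3 * B₃ := by positivity
  set a₁'' : ℝ := min a₁' (r / (O₁ * (L : ℝ) ^ 3 * B₃)) with ha''
  have ha₁'' : 0 < a₁'' := lt_min ha₁' (div_pos hr hD)
  have ha''le : a₁'' ≤ a₁' := min_le_left _ _
  have hwin : O₁ * (L : ℝ) ^ 3 * B₃ * a₁'' ≤ r := by
    have : a₁'' ≤ r / (O₁ * (L : ℝ) ^ 3 * B₃) := min_le_right _ _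
    rwa [le_div_iff₀ hD, mul_comm] at this
  refine ⟨a₁'', O₁, ha₁'', hO₁, fun F hF n K hnK ε₁ hε₁ V hV U₀ hreg hfib hε₁a => ?_⟩
  subst hF
  have hA3 : C * (2 * (O₁ * (F.L : ℝ) ^ 3 * B₃ * a₁'')) ≤ 1 / 3 := by
    calc C * (2 * (O₁ * (F.L : ℝ) ^ 3 * B₃ * a₁'')) ≤ C * (2 * r) := by gcongr
      _ ≤ 1 / 3 := hr3
  have hA2 : 2 * (2 * (O₁ * (F.L : ℝ) ^ 3 * B₃ * a₁'')) ≤ 2 * deltaSU (Fin 2) / (((3 + 4) * F.L : ℕ) : ℝ) ^ 2 := by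
    calc 2 * (2 * (O₁ * (F.L : ℝ) ^ 3 * B₃ * a₁'')) ≤ 2 * (2 * r) := by gcongr
      _ ≤ 2 * deltaSU (Fin 2) / M := hr2
  exact existenceMinimalOrbit_of_plaqInterior F hB₃pos hO₁ hA3 hA2
    (fun n K hnK ε₁ hε₁ hε₁a V hV U₀ hreg hfib Ū hŪ hmin =>
      hI F rfl n K hnK ε₁ hε₁ (hε₁a.trans ha''le) V hV U₀ hreg hfib Ū hŪ hmin)
    n K hnK ε₁ hε₁ V hV U₀ hreg hfib hε₁a

end Existence

end Summit.QuantumFields.YangMills.Theorems.Prop7ClosedFibreMinimiser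

end
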